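import Summits.QuantumAdvantage.QuantumAdvantage.Theorems.WalkTwoStepSparsePinnedFibre

/-!
# (G♯) local engine — toward `DensePinned p`: LOCALITY of the fire bits on a pinned part

Cell qa-qnc0, rung (G♯) = item stmt-QuantumAdvantage-23121 (planner qa-qnc0-p2 g24, ask P2-24b, ROUND-24 §1ter REVISION (b)); prover
qn-prover-3 g15.  First, architecture-independent step of the dense pinned branch: on a part `Q = part S d₀ w u₀` (class `w`, boundary bits
and the residues `N(τ) mod p` at the far-split times pinned) the FIRE bit of a cut is CONSTANT unless the cut is genuinely local:
* `y_eq_of_wt_wtPrefix_eq` — the fire bit depends on `(N(s_g) mod p, W mod p)` only;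
* `y_const_on_part_of_alpha_eq_beta` — class cuts (`α = β`) read `W mod p` only;
* `y_const_on_part_of_far` — a FAR cut's split is a pin time, so its split residue is pinned;
* `y_const_on_part_of_split_le` / `y_const_on_part_of_le_split` — a split inside the pinned boundary (`s ≤ p` or `n ≤ s + p`) reads pinned
  bits only (for `s ≥ n − p` through `N(s) = W − #{i ≥ s : u_i}`);
* `near_of_y_nonconst_on_part` — hence a cut whose fire bit is NOT constant on the part has `α ≠ β`, `p < s_g`, `s_g + p < n`, and is
  not far: either `|s_g − g| < d₀` with `1 ≤ g < n`, or it sits at position `0` or `n`.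
So on a part every cut is a local observable of the walk (the input to the transfer-operator bookkeeping of `DensePinned`).
WHAT THIS IS NOT: no operator theory, no `DensePinned` yet; separation NOT moved.
-/

namespace Summit.QuantumAdvantage.AdviceFreeQNC0.LocalEngine

open Finset Classical
open Summit.QuantumAdvantage.AdviceFreeQNC0.Coset21.RungG (classOf)

section Locality

variable {p : ℕ} {n : ℕ}

/-- The fire bit of a cut depends on `(N(s_g) mod p, W mod p)` only. -/
theorem y_eq_of_wt_wtPrefix_eq (S : TwoStep p n) (g : Fin (n + 1)) (u v : Fin n → Bool)
    (hW : ((wt u : ℕ) : ZMod p) = ((wt v : ℕ) : ZMod p))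
    (hN : ((wtPrefix u (S.s g) : ℕ) : ZMod p) = ((wtPrefix v (S.s g) : ℕ) : ZMod p)) :
    S.y g u = S.y g v := by
  rw [y_eq_decide, y_eq_decide, hW, hN]

/-- Members of a part have the class residue `W ≡ w (mod p)`. -/
theorem wt_cast_eq_of_mem_part (S : TwoStep p n) (d₀ : ℕ) (w : ZMod p) (u₀ u : Fin n → Bool) (hu : u ∈ part S d₀ w u₀) :
    ((wt u : ℕ) : ZMod p) = w := by
  unfold part Coset21.RungG.classOf at hu
  rw [Finset.mem_filter, Finset.mem_filter] at hu
  exact hu.1.2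

/-- Members of a part share the pin key. -/
theorem pinKey_eq_of_mem_part (S : TwoStep p n) (d₀ : ℕ) (w : ZMod p) (u₀ u : Fin n → Bool) (hu : u ∈ part S d₀ w u₀) :
    pinKey S d₀ u = pinKey S d₀ u₀ := by
  unfold part at hu
  rw [Finset.mem_filter] at hu
  exact hu.2

/-- Members of a part agree on the residues mod `p` at the pin times. -/
theorem wtPrefix_cast_eq_of_mem_part (S : TwoStep p n) (d₀ : ℕ) (w : ZMod p) (u₀ u v : Fin n → Bool)
    (hu : u ∈ part S d₀ w u₀) (hv : v ∈ part S d₀ w u₀) (τ : Fin (n + 1)) (hτ : τ ∈ pinTimes S d₀) :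
    ((wtPrefix u τ.val : ℕ) : ZMod p) = ((wtPrefix v τ.val : ℕ) : ZMod p) := by
  have hk := (pinKey_eq_of_mem_part S d₀ w u₀ u hu).trans (pinKey_eq_of_mem_part S d₀ w u₀ v hv).symm
  have h1 := congrArg (fun k => k.1 τ) hk
  simp only [pinKey, if_pos hτ] at h1
  exact h1

/-- Members of a part agree on the boundary bits. -/
theorem apply_eq_of_mem_part (S : TwoStep p n) (d₀ : ℕ) (w : ZMod p) (u₀ u v : Fin n → Bool)
    (hu : u ∈ part S d₀ w u₀) (hv : v ∈ part S d₀ w u₀) (i : Fin n) (hi : i ∈ bdry p n) : u i = v i := by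
  have hk := (pinKey_eq_of_mem_part S d₀ w u₀ u hu).trans (pinKey_eq_of_mem_part S d₀ w u₀ v hv).symm
  have h1 := congrArg (fun k => k.2 i) hk
  simp only [pinKey, if_pos hi] at h1
  exact h1

/-- **Class cuts**: `α = β` ⇒ the fire bit is constant on the part. -/
theorem y_const_on_part_of_alpha_eq_beta (S : TwoStep p n) (d₀ : ℕ) (w : ZMod p) (u₀ : Fin n → Bool) (g : Fin (n + 1))
    (hαβ : S.α g = S.β g) (u v : Fin n → Bool) (hu : u ∈ part S d₀ w u₀) (hv : v ∈ part S d₀ w u₀) :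
    S.y g u = S.y g v := by
  rw [y_eq_decide, y_eq_decide, hαβ, wt_cast_eq_of_mem_part S d₀ w u₀ u hu, wt_cast_eq_of_mem_part S d₀ w u₀ v hv]
  have e1 : S.β g * ((wtPrefix u (S.s g) : ℕ) : ZMod p) + S.β g * (w - ((wtPrefix u (S.s g) : ℕ) : ZMod p)) = S.β g * w := by ring
  have e2 : S.β g * ((wtPrefix v (S.s g) : ℕ) : ZMod p) + S.β g * (w - ((wtPrefix v (S.s g) : ℕ) : ZMod p)) = S.β g * w := by ring
  rw [e1, e2]

/-- **Far cuts**: the split of a far cut is a pin time, so its fire bit is constant on the part. -/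
theorem y_const_on_part_of_far (S : TwoStep p n) (d₀ : ℕ) (w : ZMod p) (u₀ : Fin n → Bool) (g : Fin (n + 1))
    (hfar : Far S d₀ g) (u v : Fin n → Bool) (hu : u ∈ part S d₀ w u₀) (hv : v ∈ part S d₀ w u₀) :
    S.y g u = S.y g v := by
  have hsn : S.s g + p ≤ n := hfar.2.2.2.2
  set τ : Fin (n + 1) := ⟨S.s g % (n + 1), Nat.mod_lt _ (Nat.succ_pos n)⟩ with hτdef
  have hτval : τ.val = S.s g := Nat.mod_eq_of_lt (by omega)
  have hτ : τ ∈ pinTimes S d₀ := by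
    unfold pinTimes
    rw [Finset.mem_image]
    exact ⟨g, by rw [Finset.mem_filter]; exact ⟨Finset.mem_univ _, hfar⟩, rfl⟩
  have hN := wtPrefix_cast_eq_of_mem_part S d₀ w u₀ u v hu hv τ hτ
  rw [hτval] at hN
  exact y_eq_of_wt_wtPrefix_eq S g u v
    (by rw [wt_cast_eq_of_mem_part S d₀ w u₀ u hu, wt_cast_eq_of_mem_part S d₀ w u₀ v hv]) hN

/-- Prefix counts up to a time inside the left boundary read pinned bits only. -/
theorem wtPrefix_eq_of_mem_part_of_le (S : TwoStep p n) (d₀ : ℕ) (w : ZMod p) (u₀ u v : Fin n → Bool)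
    (hu : u ∈ part S d₀ w u₀) (hv : v ∈ part S d₀ w u₀) {s : ℕ} (hs : s ≤ p) : wtPrefix u s = wtPrefix v s := by
  unfold wtPrefix
  congr 1
  ext i
  simp only [Finset.mem_filter, Finset.mem_univ, true_and]
  constructor
  · rintro ⟨h1, h2⟩
    have hi : i ∈ bdry p n := by unfold bdry; rw [Finset.mem_filter]; exact ⟨Finset.mem_univ _, Or.inl (by omega)⟩
    exact ⟨h1, by rw [← apply_eq_of_mem_part S d₀ w u₀ u v hu hv i hi]; exact h2⟩
  · rintro ⟨h1, h2⟩
    have hi : i ∈ bdry p n := by unfold bdry; rw [Finset.mem_filter]; exact ⟨Finset.mem_univ _, Or.inl (by omega)⟩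
    exact ⟨h1, by rw [apply_eq_of_mem_part S d₀ w u₀ u v hu hv i hi]; exact h2⟩

/-- **Left boundary splits**: `s_g ≤ p` ⇒ the fire bit is constant on the part. -/
theorem y_const_on_part_of_split_le (S : TwoStep p n) (d₀ : ℕ) (w : ZMod p) (u₀ : Fin n → Bool) (g : Fin (n + 1))
    (hs : S.s g ≤ p) (u v : Fin n → Bool) (hu : u ∈ part S d₀ w u₀) (hv : v ∈ part S d₀ w u₀) :
    S.y g u = S.y g v :=
  y_eq_of_wt_wtPrefix_eq S g u v
    (by rw [wt_cast_eq_of_mem_part S d₀ w u₀ u hu, wt_cast_eq_of_mem_part S d₀ w u₀ v hv])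
    (by rw [wtPrefix_eq_of_mem_part_of_le S d₀ w u₀ u v hu hv hs])

/-- The suffix count past a time inside the right boundary reads pinned bits only. -/
theorem suffix_eq_of_mem_part_of_le (S : TwoStep p n) (d₀ : ℕ) (w : ZMod p) (u₀ u v : Fin n → Bool)
    (hu : u ∈ part S d₀ w u₀) (hv : v ∈ part S d₀ w u₀) {s : ℕ} (hs : n ≤ s + p) :
    (univ.filter fun i : Fin n => s ≤ i.val ∧ u i = true).card = (univ.filter fun i : Fin n => s ≤ i.val ∧ v i = true).card := by
  congr 1
  ext i
  simp only [Finset.mem_filter, Finset.mem_univ, true_and]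
  constructor
  · rintro ⟨h1, h2⟩
    have hi : i ∈ bdry p n := by unfold bdry; rw [Finset.mem_filter]; exact ⟨Finset.mem_univ _, Or.inr (by omega)⟩
    exact ⟨h1, by rw [← apply_eq_of_mem_part S d₀ w u₀ u v hu hv i hi]; exact h2⟩
  · rintro ⟨h1, h2⟩
    have hi : i ∈ bdry p n := by unfold bdry; rw [Finset.mem_filter]; exact ⟨Finset.mem_univ _, Or.inr (by omega)⟩
    exact ⟨h1, by rw [apply_eq_of_mem_part S d₀ w u₀ u v hu hv i hi]; exact h2⟩

/-- **Right boundary splits**: `n ≤ s_g + p` ⇒ the fire bit is constant on the part (`N(s) = W − #{i ≥ s : u_i}`, both pinned mod `p`). -/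
theorem y_const_on_part_of_le_split (S : TwoStep p n) (d₀ : ℕ) (w : ZMod p) (u₀ : Fin n → Bool) (g : Fin (n + 1))
    (hs : n ≤ S.s g + p) (u v : Fin n → Bool) (hu : u ∈ part S d₀ w u₀) (hv : v ∈ part S d₀ w u₀) :
    S.y g u = S.y g v := by
  have hWu := wt_cast_eq_of_mem_part S d₀ w u₀ u hu
  have hWv := wt_cast_eq_of_mem_part S d₀ w u₀ v hv
  apply y_eq_of_wt_wtPrefix_eq S g u v (by rw [hWu, hWv])
  have eu := wt_eq_wtPrefix_add_card u (S.s g)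
  have ev := wt_eq_wtPrefix_add_card v (S.s g)
  have hsuf := suffix_eq_of_mem_part_of_le S d₀ w u₀ u v hu hv hs
  have h1 : ((wtPrefix u (S.s g) : ℕ) : ZMod p) = ((wt u : ℕ) : ZMod p)
      - (((univ.filter fun i : Fin n => S.s g ≤ i.val ∧ u i = true).card : ℕ) : ZMod p) := by
    rw [eu, Nat.cast_add]; ring
  have h2 : ((wtPrefix v (S.s g) : ℕ) : ZMod p) = ((wt v : ℕ) : ZMod p)
      - (((univ.filter fun i : Fin n => S.s g ≤ i.val ∧ v i = true).card : ℕ) : ZMod p) := by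
    rw [ev, Nat.cast_add]; ring
  rw [h1, h2, hWu, hWv, hsuf]

/-- **Locality of non-constant fire bits on a part.**  A cut whose fire bit takes both values on the part is a genuine two-valued form
(`α ≠ β`) with split strictly between the boundary blocks, and is NOT far: it is either NEAR (`|s_g − g| < d₀`, interior position) or
sits at one of the two end positions `0`, `n`. -/
theorem near_of_y_nonconst_on_part (S : TwoStep p n) (d₀ : ℕ) (w : ZMod p) (u₀ : Fin n → Bool) (g : Fin (n + 1))
    (u v : Fin n → Bool) (hu : u ∈ part S d₀ w u₀) (hv : v ∈ part S d₀ w u₀) (hne : S.y g u ≠ S.y g v) :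
    S.α g ≠ S.β g ∧ p < S.s g ∧ S.s g + p < n ∧
      ((1 ≤ g.val ∧ g.val < n ∧ S.s g < g.val + d₀ ∧ g.val < S.s g + d₀) ∨ g.val = 0 ∨ g.val = n) := by
  have hαβ : S.α g ≠ S.β g := fun h => hne (y_const_on_part_of_alpha_eq_beta S d₀ w u₀ g h u v hu hv)
  have hs1 : p < S.s g := by
    by_contra h; push Not at h
    exact hne (y_const_on_part_of_split_le S d₀ w u₀ g h u v hu hv)
  have hs2 : S.s g + p < n := by
    by_contra h; push Not at h
    exact hne (y_const_on_part_of_le_split S d₀ w u₀ g h u v hu hv)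
  have hnotfar : ¬ Far S d₀ g := fun h => hne (y_const_on_part_of_far S d₀ w u₀ g h u v hu hv)
  refine ⟨hαβ, hs1, hs2, ?_⟩
  have hg := g.isLt
  by_cases h0 : g.val = 0
  · exact Or.inr (Or.inl h0)
  by_cases hn : g.val = n
  · exact Or.inr (Or.inr hn)
  left
  refine ⟨by omega, by omega, ?_, ?_⟩
  · by_contra h; push Not at h
    exact hnotfar ⟨hαβ, ⟨by omega, by omega⟩, Or.inl h, hs1.le, hs2.le⟩
  · by_contra h; push Not at h
    exact hnotfar ⟨hαβ, ⟨by omega, by omega⟩, Or.inr h, hs1.le, hs2.le⟩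

end Locality

end Summit.QuantumAdvantage.AdviceFreeQNC0.LocalEngine
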